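import Summits.MatrixMultiplication.MatrixMultiplication.Theorems.AbelianSTPPCensusTC2StatDefs

/-!
# T_C static certificate, range `2881 … 3003` (t*-indexed linear checker with the k-member tree at `τ = 12/5`): kernel evaluation, the completeness of the bucket lists, volumes `1501 … 3003` (small volume chunks: the kernel recursion through the long low-`t` lists is bounded per theorem)

Cell mm-stpp (rung F-M1), tier T_C = «beat `2.4`»; checker in `AbelianSTPPCensusTC2StatDefs.lean`, table and bucket lists in `AbelianSTPPCensusTC2StatData.lean`
(pattern: theory g12's `AbelianSTPPCensusTAStatDDom*/DCk*.lean`).  `decide` with kernel reduction (standard axioms; no `native_decide`), `Elab.async false`;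
consumed by `TC2Stat.checkV_sound` / `TC2Stat.domV_sound` / `TC2Stat.m2V_sound` in the leaf `AbelianSTPPCensusLeafTC3003Closed.lean`.
WHAT THIS IS NOT: arithmetic on shape lists only; no statement about STPP families or `ω`.
-/

set_option linter.dupNamespace false
set_option autoImplicit false
set_option Elab.async false

namespace Summit.MatrixMultiplication.MatrixMultiplication.Theorems.TC2Stat

set_option maxHeartbeats 0 in
/-- Completeness chunk: every sorted candidate shape of the volumes `1501 … 1550` lies in the list of the bucket of its `a·b` (323 shapes). [original] -/
theorem m2c1501 : TC2Stat.m2V 50 1501 = true := by decide +kernel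

set_option maxHeartbeats 0 in
/-- Completeness chunk: every sorted candidate shape of the volumes `1551 … 1750` lies in the list of the bucket of its `a·b` (1346 shapes). [original] -/
theorem m2c1551 : TC2Stat.m2V 200 1551 = true := by decide +kernel

set_option maxHeartbeats 0 in
/-- Completeness chunk: every sorted candidate shape of the volumes `1751 … 1950` lies in the list of the bucket of its `a·b` (1393 shapes). [original] -/
theorem m2c1751 : TC2Stat.m2V 200 1751 = true := by decide +kernel

set_option maxHeartbeats 0 in
/-- Completeness chunk: every sorted candidate shape of the volumes `1951 … 2150` lies in the list of the bucket of its `a·b` (1318 shapes). [original] -/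
theorem m2c1951 : TC2Stat.m2V 200 1951 = true := by decide +kernel

set_option maxHeartbeats 0 in
/-- Completeness chunk: every sorted candidate shape of the volumes `2151 … 2350` lies in the list of the bucket of its `a·b` (1312 shapes). [original] -/
theorem m2c2151 : TC2Stat.m2V 200 2151 = true := by decide +kernel

set_option maxHeartbeats 0 in
/-- Completeness chunk: every sorted candidate shape of the volumes `2351 … 2550` lies in the list of the bucket of its `a·b` (1236 shapes). [original] -/
theorem m2c2351 : TC2Stat.m2V 200 2351 = true := by decide +kernel

set_option maxHeartbeats 0 in
/-- Completeness chunk: every sorted candidate shape of the volumes `2551 … 2750` lies in the list of the bucket of its `a·b` (1063 shapes). [original] -/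
theorem m2c2551 : TC2Stat.m2V 200 2551 = true := by decide +kernel

set_option maxHeartbeats 0 in
/-- Completeness chunk: every sorted candidate shape of the volumes `2751 … 2950` lies in the list of the bucket of its `a·b` (731 shapes). [original] -/
theorem m2c2751 : TC2Stat.m2V 200 2751 = true := by decide +kernel

set_option maxHeartbeats 0 in
/-- Completeness chunk: every sorted candidate shape of the volumes `2951 … 3003` lies in the list of the bucket of its `a·b` (27 shapes). [original] -/
theorem m2c2951 : TC2Stat.m2V 53 2951 = true := by decide +kernel

end Summit.MatrixMultiplication.MatrixMultiplication.Theorems.TC2Stat
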